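import Summits.NavierStokesRegularity.OSWSelfSimilar.SheetRAssemblyOperators
import Summits.NavierStokesRegularity.OSWSelfSimilar.SheetRSolutionOperatorPerturbation
import Summits.NavierStokesRegularity.OSWSelfSimilar.CertificateViscousSheetRFixedPoint
import HarnessLib

/-!
# SHEET-ℝ frame, MODEL ASSEMBLY layer 4b: the row theorem `existsUnique_fixedPoint_of_row_w` INSTANTIATED on the concrete Hilbert
# spaces, with the solution operator of `DG(Ω̄) = B_λ − P` glued from `B_λ⁻¹` and the certificate's finite-rank/Neumann inverse

HONEST FRAMING (cell ns-blowup GROUP B / zone Z3, case Z3-SR-CERT; 1-D MODEL certificate (viscous gCLM/OSW sheet on the line at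
`(a, c_l, ε) = (1/5, 1/2, 1)`); computer-assisted; not Euler/NS; «violates: none — MODEL»).  NOTHING here asserts that the certificate's
numbers hold: the interval arithmetic of record enters as HYPOTHESES, by name — (C1) the coercivity `hcoer` of the linearised form
(`κ = c_λ = 1`), (C2)/(C3) a two-sided inverse `M` of `1 − S₀∘P` on the energy space with `‖M (S₀ g)‖_E ≤ K_w‖g‖_w`,
`K_w = KNw/(1 − KNw·epsN)` (the Woodbury/Neumann step of PRICE-impl1 §2), and the residual bound `‖g₀‖_w ≤ eta`.  What IS kernel-checked
here is the ASSEMBLY: that these hypotheses, about the concrete objects, give exactly one fixed point in the row's ball.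

* §1 `IsCentre L Ω̄ Ω̄₁ H₀` — the centre as an odd energy-class profile (`Ω̄ = ∫₀Ω̄₁`, weights finite, `|HΩ̄| ≤ H₀`); the coefficients
  `drift a Ω̄ = ½ξ + a𝒰̄` and `potential L λ Ω̄ = 1 − HΩ̄ + λχ` of `B_λ = −∂² + d∂ + V` with their measurability and growth bounds
  (`|d| ≤ D₀ + ½|ξ|`, `|V| ≤ 1 + H₀ + |λ|`), so that layer 3 (`SheetRSolutionOperator`) applies; `PopC` = layer 4a's `Pop` at the centre.
* §2 the glue: for ANY solution operator `S₀` of `B_λ` (exists: `exists_solutionOperator`; unique: `solution_unique`) and any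
  right inverse `M` of `1 − S₀∘PopC`, `T := M∘S₀` solves the weak equation of `(B_λ − P)u = g` (`perturbed_weak_eq`).
* §3 **`existsUnique_fixedPoint_assembled`** — `CertificateViscousSheetR.existsUnique_fixedPoint_of_row_w` with `E := Esp 8 _`,
  `W := W 8`, `S := T`, `Q := Qop _ (1/5)`, `hLlip := four_Mw_le_Llip`: for `‖T g‖ ≤ K_w‖g‖` and `‖g₀‖ ≤ eta` there is EXACTLY ONE `δ`
  in the closed `E`-ball of radius `rE` with `δ = −T(g₀ + Q δ δ)`.
* §4 the reading in the frame's function language: the fixed point satisfies the LINEARISED WEAK EQUATION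
  `linForm(δ; v) = ∫ w·(Pδ − g₀ − Qδδ)·v` for every compactly supported test (`linearised_weak_eq_of_fixedPoint`), and conversely every
  `δ'` in the ball satisfying it IS the fixed point (`eq_fixedPoint_of_linearised_weak_eq`, using `solution_unique` and the LEFT inverse
  property of `M`) — so the certified `δ` is unique among energy-class solutions of the linearised weak equation in the ball.
One `Prop`-structure (`IsCentre`), three definitions (`drift`, `potential`, `PopC`); no named fact.  WHAT THIS IS NOT: not NS; not the interval
arithmetic; the passage to the `C_c^∞`-tested profile equation (W) and the MODEL blow-up is `SheetRCertificateWeakZero.lean`.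
-/

noncomputable section

namespace Summit.NavierStokesRegularity.OSWSelfSimilar
namespace SheetRCertificateAssembly

open _root_.MeasureTheory _root_.Set _root_.Filter _root_.Real _root_.Metric Literature.Analysis.Fourier SheetRWeakProfilePV SheetRWeakToStrong
  SheetREnergyClass SheetRWeightedMeasure SheetREnergySpace SheetRLinearisedTests SheetRTestSpace SheetRLinearisedFormBounds SheetRSolutionOperator
  SheetRSolutionOperatorPerturbation SheetRAssemblyOperators CertificateViscousSheetR
open scoped Topology ENNReal

/-! ### §1 The centre and the coefficients of `B_λ` -/

/-- **Centre data.** An odd energy-class profile in the primitive form of record with `Ω̄(0) = 0`: `Ω̄ = ∫₀Ω̄₁`, `Ω̄` odd, `Ω̄₁` a.e.-strongly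
measurable, `∫ w Ω̄² < ∞`, `∫ w Ω̄₁² < ∞` (`w = L² + ξ²`), and a bound `|HΩ̄| ≤ H₀` for its Hilbert transform. [folklore] -/
structure IsCentre (L : ℝ) (Ω Ω₁ : ℝ → ℝ) (H₀ : ℝ) : Prop where
  /-- primitive form `Ω̄ = ∫₀ Ω̄₁` -/
  primitive : ∀ x, Ω x = ∫ s in (0 : ℝ)..x, Ω₁ s
  /-- `Ω̄` is odd -/
  odd : ∀ y, Ω (-y) = -Ω y
  /-- `Ω̄₁` is a.e.-strongly measurable -/
  measurable : AEStronglyMeasurable Ω₁ volume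
  /-- `∫ (L²+ξ²) Ω̄² < ∞` -/
  weight₀ : Integrable fun y => (L ^ 2 + y ^ 2) * Ω y ^ 2
  /-- `∫ (L²+ξ²) Ω̄₁² < ∞` -/
  weight₁ : Integrable fun y => (L ^ 2 + y ^ 2) * Ω₁ y ^ 2
  /-- `|HΩ̄| ≤ H₀` -/
  hilbert_le : ∀ ξ, |hilbertTransform Ω ξ| ≤ H₀

namespace IsCentre

variable {L : ℝ} {Ω Ω₁ : ℝ → ℝ} {H₀ : ℝ}

/-- The primitive form with the base point written out. [folklore] -/
theorem primitive' (hc : IsCentre L Ω Ω₁ H₀) (x : ℝ) : Ω x = Ω 0 + ∫ s in (0 : ℝ)..x, Ω₁ s := by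
  rw [hc.primitive x, hc.primitive 0, intervalIntegral.integral_same, zero_add]

/-- `Ω̄` is continuous, `L¹ ∩ L²`, `Ω̄₁ ∈ L²`, and `|Ω̄| ≤ (√2/L)(∫w(Ω̄₁² + ¼Ω̄²))^{1/2}`. [folklore] -/
theorem basic (hL : 0 < L) (hc : IsCentre L Ω Ω₁ H₀) :
    Continuous Ω ∧ MemLp Ω₁ 2 volume ∧ MemLp Ω 2 volume ∧ Integrable Ω ∧
      ∀ y, |Ω y| ≤ Real.sqrt 2 / L * Real.sqrt (∫ y, (L ^ 2 + y ^ 2) * (Ω₁ y ^ 2 + 1 / 4 * Ω y ^ 2)) := by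
  obtain ⟨h1, h2, h3, h4, -⟩ := basic_of_primitive hL hc.primitive' hc.measurable hc.weight₀ hc.weight₁
  exact ⟨h1, h2, h3, h4, fun y => abs_le_sqrt_two_div_mul_energy_of_primitive hL hc.primitive' hc.measurable hc.weight₀ hc.weight₁ y⟩

end IsCentre

/-- The drift of `B_λ`: `d = ½ξ + a𝒰̄`, `𝒰̄ = ∫₀ HΩ̄`. [folklore] -/
def drift (a : ℝ) (Ω : ℝ → ℝ) (ξ : ℝ) : ℝ := ξ / 2 + a * ∫ s in (0 : ℝ)..ξ, hilbertTransform Ω s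

/-- The potential of `B_λ`: `V = 1 − HΩ̄ + λχ`, `χ = L²/(L²+ξ²)`. [folklore] -/
def potential (L lam : ℝ) (Ω : ℝ → ℝ) (ξ : ℝ) : ℝ := 1 - hilbertTransform Ω ξ + lam * (L ^ 2 / (L ^ 2 + ξ ^ 2))

section Coefficients

variable {L : ℝ} (hL : 0 < L) (lam a : ℝ) {Ω Ω₁ : ℝ → ℝ} {H₀ : ℝ} (hc : IsCentre L Ω Ω₁ H₀)
include hL hc

/-- Measurability and growth of the coefficients: `d`, `V` a.e.-strongly measurable, `|d ξ| ≤ |a|(π/(4L))^{1/2}‖Ω̄‖_w + ½|ξ|`,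
`|V ξ| ≤ 1 + H₀ + |λ|` — the hypothesis list of `SheetRSolutionOperator.exists_solutionOperator`. [folklore] -/
theorem coef_bounds :
    AEStronglyMeasurable (drift a Ω) volume ∧ AEStronglyMeasurable (potential L lam Ω) volume ∧
    (∀ ξ, |drift a Ω ξ| ≤ |a| * (Real.sqrt (π / (4 * L)) * Real.sqrt (∫ y, (L ^ 2 + y ^ 2) * Ω y ^ 2)) + 1 / 2 * |ξ|) ∧
    (∀ ξ, |potential L lam Ω ξ| ≤ 1 + H₀ + |lam|) := by
  obtain ⟨hΩc, hΩ₁2, hΩ2, hΩi, -⟩ := hc.basic hL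
  obtain ⟨hHm, -, -, -⟩ := weightedSq_hilbertTransform_of_primitive hL hc.primitive' hc.odd hc.measurable hc.weight₀ hc.weight₁
  have hUc : Continuous fun ξ => ∫ s in (0 : ℝ)..ξ, hilbertTransform Ω s := continuous_velocity_of_primitive hc.primitive' hΩ₁2 hΩi hΩ2
  refine ⟨?_, ?_, fun ξ => ?_, fun ξ => ?_⟩
  · exact ((by fun_prop : Continuous fun ξ : ℝ => ξ / 2).add (continuous_const.mul hUc)).aestronglyMeasurable
  · refine (aestronglyMeasurable_const.sub hHm).add ?_
    exact (continuous_const.mul (continuous_const.div (by fun_prop) fun ξ => by positivity)).aestronglyMeasurable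
  · have hU := abs_velocity_le_of_primitive hL hc.primitive' hc.odd hc.measurable hc.weight₀ hc.weight₁ ξ
    unfold drift
    calc |ξ / 2 + a * ∫ s in (0 : ℝ)..ξ, hilbertTransform Ω s| ≤ |ξ / 2| + |a * ∫ s in (0 : ℝ)..ξ, hilbertTransform Ω s| := abs_add_le _ _
      _ ≤ 1 / 2 * |ξ| + |a| * (Real.sqrt (π / (4 * L)) * Real.sqrt (∫ y, (L ^ 2 + y ^ 2) * Ω y ^ 2)) := by
          rw [abs_div, abs_two, abs_mul]
          exact add_le_add (by linarith) (mul_le_mul_of_nonneg_left hU (abs_nonneg a))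
      _ = _ := by ring
  · have hχ0 : 0 ≤ L ^ 2 / (L ^ 2 + ξ ^ 2) := by positivity
    have hχ1 : L ^ 2 / (L ^ 2 + ξ ^ 2) ≤ 1 := by rw [div_le_one (by positivity)]; nlinarith [sq_nonneg ξ]
    unfold potential
    calc |1 - hilbertTransform Ω ξ + lam * (L ^ 2 / (L ^ 2 + ξ ^ 2))|
        ≤ |1 - hilbertTransform Ω ξ| + |lam * (L ^ 2 / (L ^ 2 + ξ ^ 2))| := abs_add_le _ _
      _ ≤ (1 + H₀) + |lam| := by
          have h1 : |1 - hilbertTransform Ω ξ| ≤ 1 + H₀ := by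
            have h := abs_sub (1 : ℝ) (hilbertTransform Ω ξ)
            rw [abs_one] at h
            linarith [hc.hilbert_le ξ]
          have h2 : |lam * (L ^ 2 / (L ^ 2 + ξ ^ 2))| ≤ |lam| := by
            rw [abs_mul, abs_of_nonneg hχ0]; exact mul_le_of_le_one_right (abs_nonneg _) hχ1
          exact add_le_add h1 h2
      _ = 1 + H₀ + |lam| := by ring

/-- **The certificate's `P` at the centre**: `PopC = Pop` of layer 4a with `B₀ = (√2/L)‖Ω̄‖_E` (the (E4) sup bound of the centre). [folklore] -/
def PopC : Esp L hL →L[ℝ] W L :=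
  Pop hL lam a (hc.basic hL).1.aestronglyMeasurable (by positivity) (hc.basic hL).2.2.2.2 hc.measurable hc.weight₁

/-- `PopC p` is the `L²_w` class of `P u = λχu + Ω̄·Hu − aΩ̄₁·𝒰u`, `u = prim (der p)`. [folklore] -/
theorem PopC_apply (p : Esp L hL) : (((PopC hL lam a hc p : W L)) : ℝ → ℝ) =ᵐ[volume] PopFun L lam a Ω Ω₁ p :=
  (Pop_apply hL lam a (hc.basic hL).1.aestronglyMeasurable (by positivity) (hc.basic hL).2.2.2.2 hc.measurable hc.weight₁ p).1

end Coefficients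

/-! ### §2 The glue: `T := M ∘ S₀` solves the weak equation of `B_λ − P` -/

section Glue

variable {L : ℝ} (hL : 0 < L) (lam a : ℝ) {Ω Ω₁ : ℝ → ℝ} {H₀ : ℝ} (hc : IsCentre L Ω Ω₁ H₀)
include hc

/-- **Perturbed weak equation.** If `S₀ : W L →L Esp` solves the weak equation of `B_λ` (`linForm(S₀ g; v) = ∫ w g v` on compactly
supported tests) and `M` is a right inverse of `1 − S₀∘PopC` (`M x − S₀ (PopC (M x)) = x`), then `T := M∘S₀` solves
`linForm(T g; v) = ∫ w (g + PopC (T g)) v` — the weak equation of `(B_λ − P)u = g`. [folklore] -/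
theorem perturbed_weak_eq (S₀ : W L →L[ℝ] Esp L hL)
    (hS₀ : ∀ (g : W L) (v v₁ : ℝ → ℝ), IsCompactTest v v₁ →
      linForm L (drift a Ω) (potential L lam Ω) (prim (der (S₀ g))) (der (S₀ g)) v v₁ = ∫ y, (L ^ 2 + y ^ 2) * ((g : ℝ → ℝ) y * v y))
    (M : Esp L hL →L[ℝ] Esp L hL) (hM : ∀ x, M x - S₀ (PopC hL lam a hc (M x)) = x) (g : W L) {v v₁ : ℝ → ℝ}
    (hv : IsCompactTest v v₁) :
    linForm L (drift a Ω) (potential L lam Ω) (prim (der ((M.comp S₀) g))) (der ((M.comp S₀) g)) v v₁ =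
      ∫ y, (L ^ 2 + y ^ 2) * (((g + PopC hL lam a hc ((M.comp S₀) g) : W L) : ℝ → ℝ) y * v y) := by
  obtain ⟨hdm, hVm, hd, hV⟩ := coef_bounds hL lam a hc
  have hS₀' : ∀ (g : W L) (φ : testSpace), Eform hL hdm hVm (by norm_num : (0:ℝ) ≤ 1 / 2) hd hV (S₀ g) φ = Pdata hL g φ := by
    intro g φ
    rw [Eform_apply, Pdata_apply]
    exact hS₀ g φ.1.1 φ.1.2 φ.2
  have h := (solutionOperator_sub_of_rightInverse (Eform hL hdm hVm (by norm_num : (0:ℝ) ≤ 1 / 2) hd hV) (Pdata hL) S₀ hS₀'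
    (PopC hL lam a hc) M hM).1 g ⟨(v, v₁), hv⟩
  rw [Eform_apply, Pdata_apply] at h
  exact h

end Glue

/-! ### §3 The row theorem instantiated: the frame `L = 8`, `a = 1/5`, `λ = 4` -/

/-- `0 < 8`. [folklore] -/
theorem eight_pos : (0 : ℝ) < 8 := by norm_num

/-- The `w → E` constant of the solution operator of `DG(Ω̄)`: `K_w = KNw/(1 − KNw·epsN)` (row literals of `CertificateViscousSheetR`). [folklore] -/
theorem Kw_eq : ((KNw / (1 - KNw * epsN) : ℚ) : ℝ) = (KNw : ℝ) / (1 - (KNw : ℝ) * (epsN : ℝ)) := by push_cast; ring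

/-- **THE ASSEMBLED ROW.**  On the concrete spaces `E := Esp 8 _` (energy space) and `W := W 8` (`L²_w`), with the sheet's own quadratic
operator `Qop _ (1/5)` (bound `M_w`, `4M_w ≤ Llip` by `four_Mw_le_Llip`): for ANY bounded linear `T : W →L E` with
`‖T g‖ ≤ K_w‖g‖`, `K_w = KNw/(1 − KNw·epsN)` (the certificate's `‖DG(Ω̄)⁻¹‖_{L²_w → E}`), and any residual `g₀ ∈ W` with `‖g₀‖ ≤ eta`,
the closed `E`-ball of radius `rE` about `0` contains EXACTLY ONE `δ` with `δ = −T(g₀ + Q δ δ)`.  MODEL; the two norm hypotheses are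
the interval arithmetic of record. [folklore] -/
theorem existsUnique_fixedPoint_assembled (T : W 8 →L[ℝ] Esp 8 eight_pos)
    (hT : ∀ g, ‖T g‖ ≤ ((KNw / (1 - KNw * epsN) : ℚ) : ℝ) * ‖g‖) (g₀ : W 8) (hη : ‖g₀‖ ≤ (eta : ℝ)) :
    ∃ δ ∈ closedBall (0 : Esp 8 eight_pos) (rE : ℝ), δ = -T (g₀ + Qop eight_pos (1 / 5) δ δ) ∧
      ∀ δ' ∈ closedBall (0 : Esp 8 eight_pos) (rE : ℝ), δ' = -T (g₀ + Qop eight_pos (1 / 5) δ' δ') → δ' = δ := by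
  haveI : CompleteSpace (Esp 8 eight_pos) := completeSpace_Esp eight_pos
  exact existsUnique_fixedPoint_of_row_w T (Qop eight_pos (1 / 5)) g₀ (Mw_nonneg eight_pos _) hT
    (fun u v => (Qop_apply eight_pos (1 / 5) u v).2) four_Mw_le_Llip hη

section Assembled

variable {Ω Ω₁ : ℝ → ℝ} {H₀ : ℝ} (hc : IsCentre 8 Ω Ω₁ H₀)
  (S₀ : W 8 →L[ℝ] Esp 8 eight_pos)
  (hS₀ : ∀ (g : W 8) (v v₁ : ℝ → ℝ), IsCompactTest v v₁ →
    linForm 8 (drift (1 / 5) Ω) (potential 8 4 Ω) (prim (der (S₀ g))) (der (S₀ g)) v v₁ = ∫ y, ((8:ℝ) ^ 2 + y ^ 2) * ((g : ℝ → ℝ) y * v y))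
  (M : Esp 8 eight_pos →L[ℝ] Esp 8 eight_pos)
  (hM₁ : ∀ x, M x - S₀ (PopC eight_pos 4 (1 / 5) hc (M x)) = x)
  (hM₂ : ∀ x, M (x - S₀ (PopC eight_pos 4 (1 / 5) hc x)) = x)
  (hK : ∀ g, ‖M (S₀ g)‖ ≤ ((KNw / (1 - KNw * epsN) : ℚ) : ℝ) * ‖g‖)
  (g₀ : W 8) (hη : ‖g₀‖ ≤ (eta : ℝ))

/-! ### §4 The reading: the fixed point and the linearised weak equation -/

include hS₀ hM₁ in
/-- **Fixed point ⇒ linearised weak equation.**  If `δ = −T(g₀ + Qδδ)` with `T = M∘S₀`, then for every compactly supported test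
`(v, v₁)`: `linForm(prim (der δ), der δ; v, v₁) = ∫ w·(P δ − g₀ − Q δ δ)·v` in the frame's function language
(`P δ = PopFun`, `Q δ δ = QFun`, `g₀` any `L²_w` representative) — the weak form of `DG(Ω̄)δ = −(G(Ω̄) + Q(δ,δ))`. [folklore] -/
theorem linearised_weak_eq_of_fixedPoint {g₀f : ℝ → ℝ} (hg₀f : ((g₀ : W 8) : ℝ → ℝ) =ᵐ[volume] g₀f) {δ : Esp 8 eight_pos}
    (hfix : δ = -(M.comp S₀) (g₀ + Qop eight_pos (1 / 5) δ δ)) {v v₁ : ℝ → ℝ} (hv : IsCompactTest v v₁) :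
    linForm 8 (drift (1 / 5) Ω) (potential 8 4 Ω) (prim (der δ)) (der δ) v v₁ =
      ∫ y, ((8:ℝ) ^ 2 + y ^ 2) * ((PopFun 8 4 (1 / 5) Ω Ω₁ δ y - g₀f y - QFun 8 (1 / 5) δ δ y) * v y) := by
  set x : W 8 := -(g₀ + Qop eight_pos (1 / 5) δ δ) with hx
  have hδ : (M.comp S₀) x = δ := by rw [hx, map_neg, ← hfix]
  have h := perturbed_weak_eq eight_pos 4 (1 / 5) hc S₀ hS₀ M hM₁ x hv
  rw [hδ] at h
  rw [h]
  refine integral_congr_ae ?_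
  have h1 : (((x + PopC eight_pos 4 (1 / 5) hc δ : W 8)) : ℝ → ℝ) =ᵐ[volume]
      fun y => ((x : W 8) : ℝ → ℝ) y + ((PopC eight_pos 4 (1 / 5) hc δ : W 8) : ℝ → ℝ) y := ae_volume_of_ae_μw eight_pos (Lp.coeFn_add _ _)
  have h2 : ((x : W 8) : ℝ → ℝ) =ᵐ[volume] fun y => -(((g₀ : W 8) : ℝ → ℝ) y + ((Qop eight_pos (1 / 5) δ δ : W 8) : ℝ → ℝ) y) := by
    have ha := ae_volume_of_ae_μw eight_pos (Lp.coeFn_neg (g₀ + Qop eight_pos (1 / 5) δ δ))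
    have hb := ae_volume_of_ae_μw eight_pos (Lp.coeFn_add g₀ (Qop eight_pos (1 / 5) δ δ))
    rw [hx]
    filter_upwards [ha, hb] with y hya hyb
    rw [hya, Pi.neg_apply, hyb, Pi.add_apply]
  filter_upwards [h1, h2, hg₀f, (Qop_apply eight_pos (1 / 5) δ δ).1, PopC_apply eight_pos 4 (1 / 5) hc δ] with y hy1 hy2 hy3 hy4 hy5
  rw [hy1, hy2, hy3, hy4, hy5]
  ring

include hc hS₀ hM₂ in
/-- **Linearised weak equation ⇒ fixed point.**  Under (C1) (`hcoer`, `κ = 1`): if `δ' ∈ Esp` satisfies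
`linForm(δ'; v) = ∫ w·(Pδ' − g₀ − Qδ'δ')·v` for every compactly supported test, then `δ' = −T(g₀ + Qδ'δ')`, `T = M∘S₀` — by uniqueness of
energy-class weak solutions of `B_λ` (`solution_unique`) and the LEFT inverse property of `M`. [folklore] -/
theorem eq_fixedPoint_of_linearised_weak_eq
    (hcoer : ∀ v v₁ : ℝ → ℝ, IsCompactTest v v₁ →
      1 * ((∫ ξ, ((8:ℝ) ^ 2 + ξ ^ 2) * v₁ ξ ^ 2) + 1 / 4 * ∫ ξ, ((8:ℝ) ^ 2 + ξ ^ 2) * v ξ ^ 2) ≤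
        linForm 8 (drift (1 / 5) Ω) (potential 8 4 Ω) v v₁ v v₁)
    {g₀f : ℝ → ℝ} (hg₀f : ((g₀ : W 8) : ℝ → ℝ) =ᵐ[volume] g₀f) {δ' : Esp 8 eight_pos}
    (hweak : ∀ v v₁ : ℝ → ℝ, IsCompactTest v v₁ →
      linForm 8 (drift (1 / 5) Ω) (potential 8 4 Ω) (prim (der δ')) (der δ') v v₁ =
        ∫ y, ((8:ℝ) ^ 2 + y ^ 2) * ((PopFun 8 4 (1 / 5) Ω Ω₁ δ' y - g₀f y - QFun 8 (1 / 5) δ' δ' y) * v y)) :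
    δ' = -(M.comp S₀) (g₀ + Qop eight_pos (1 / 5) δ' δ') := by
  obtain ⟨hdm, hVm, hd, hV⟩ := coef_bounds eight_pos 4 (1 / 5) hc
  -- the datum of which `δ'` is THE weak solution: `x' := P δ' − g₀ − Q δ' δ'`
  set x' : W 8 := PopC eight_pos 4 (1 / 5) hc δ' - g₀ - Qop eight_pos (1 / 5) δ' δ' with hx'
  have hx'ae : ((x' : W 8) : ℝ → ℝ) =ᵐ[volume] fun y => PopFun 8 4 (1 / 5) Ω Ω₁ δ' y - g₀f y - QFun 8 (1 / 5) δ' δ' y := by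
    have ha := ae_volume_of_ae_μw eight_pos (Lp.coeFn_sub (PopC eight_pos 4 (1 / 5) hc δ' - g₀) (Qop eight_pos (1 / 5) δ' δ'))
    have hb := ae_volume_of_ae_μw eight_pos (Lp.coeFn_sub (PopC eight_pos 4 (1 / 5) hc δ') g₀)
    filter_upwards [ha, hb, hg₀f, (Qop_apply eight_pos (1 / 5) δ' δ').1, PopC_apply eight_pos 4 (1 / 5) hc δ'] with y h1 h2 h3 h4 h5
    rw [hx', h1, Pi.sub_apply, h2, Pi.sub_apply, h3, h4, h5]
  -- `δ'` and `S₀ x'` solve the same weak equation, hence coincide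
  have hsame : δ' = S₀ x' := by
    refine solution_unique eight_pos hdm hVm (by positivity) (by norm_num : (0:ℝ) ≤ 1 / 2) hd hV one_pos hcoer
      (rhs := fun v _ => ∫ y, ((8:ℝ) ^ 2 + y ^ 2) * (((x' : W 8) : ℝ → ℝ) y * v y)) (fun v v₁ hv => ?_) (fun v v₁ hv => hS₀ x' v v₁ hv)
    rw [hweak v v₁ hv]
    exact integral_congr_ae (hx'ae.mono fun y hy => by beta_reduce; rw [hy])
  -- `(1 − S₀ P) δ' = −S₀ (g₀ + Q δ' δ')`, then apply the left inverse `M`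
  have hkey : δ' - S₀ (PopC eight_pos 4 (1 / 5) hc δ') = -S₀ (g₀ + Qop eight_pos (1 / 5) δ' δ') := by
    nth_rewrite 1 [hsame]
    rw [hx', map_sub, map_sub, map_add]
    abel
  calc δ' = M (δ' - S₀ (PopC eight_pos 4 (1 / 5) hc δ')) := (hM₂ δ').symm
    _ = -(M.comp S₀) (g₀ + Qop eight_pos (1 / 5) δ' δ') := by rw [hkey, map_neg, ContinuousLinearMap.comp_apply]

include hc hS₀ hM₁ hM₂ hK hη in
/-- **THE ASSEMBLED CERTIFICATE (weak-equation form).**  Under the centre data, (C1) `hcoer`, the (C2)/(C3) inverse `M` with its `K_w`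
bound, and `‖g₀‖_w ≤ eta`: there is EXACTLY ONE `δ` in the closed `E`-ball of radius `rE` whose profile solves the linearised weak equation
`linForm(δ; v) = ∫ w·(Pδ − g₀ − Qδδ)·v` against every compactly supported test — the weak form, in the frame of record, of
`G(Ω̄ + δ) = G(Ω̄) + DG(Ω̄)δ + Q(δ,δ) = 0`.  MODEL statement; interval arithmetic = hypotheses. [folklore] -/
theorem existsUnique_linearised_weakSolution
    (hcoer : ∀ v v₁ : ℝ → ℝ, IsCompactTest v v₁ →
      1 * ((∫ ξ, ((8:ℝ) ^ 2 + ξ ^ 2) * v₁ ξ ^ 2) + 1 / 4 * ∫ ξ, ((8:ℝ) ^ 2 + ξ ^ 2) * v ξ ^ 2) ≤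
        linForm 8 (drift (1 / 5) Ω) (potential 8 4 Ω) v v₁ v v₁)
    {g₀f : ℝ → ℝ} (hg₀f : ((g₀ : W 8) : ℝ → ℝ) =ᵐ[volume] g₀f) :
    ∃ δ ∈ closedBall (0 : Esp 8 eight_pos) (rE : ℝ),
      (∀ v v₁ : ℝ → ℝ, IsCompactTest v v₁ →
        linForm 8 (drift (1 / 5) Ω) (potential 8 4 Ω) (prim (der δ)) (der δ) v v₁ =
          ∫ y, ((8:ℝ) ^ 2 + y ^ 2) * ((PopFun 8 4 (1 / 5) Ω Ω₁ δ y - g₀f y - QFun 8 (1 / 5) δ δ y) * v y)) ∧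
      ∀ δ' ∈ closedBall (0 : Esp 8 eight_pos) (rE : ℝ),
        (∀ v v₁ : ℝ → ℝ, IsCompactTest v v₁ →
          linForm 8 (drift (1 / 5) Ω) (potential 8 4 Ω) (prim (der δ')) (der δ') v v₁ =
            ∫ y, ((8:ℝ) ^ 2 + y ^ 2) * ((PopFun 8 4 (1 / 5) Ω Ω₁ δ' y - g₀f y - QFun 8 (1 / 5) δ' δ' y) * v y)) → δ' = δ := by
  obtain ⟨δ, hball, hfix, huniq⟩ := existsUnique_fixedPoint_assembled (M.comp S₀) (fun g => hK g) g₀ hη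
  refine ⟨δ, hball, fun v v₁ hv => linearised_weak_eq_of_fixedPoint hc S₀ hS₀ M hM₁ g₀ hg₀f hfix hv, fun δ' hδ' hweak' => ?_⟩
  exact huniq δ' hδ' (eq_fixedPoint_of_linearised_weak_eq hc S₀ hS₀ M hM₂ g₀ hcoer hg₀f hweak')

end Assembled

end SheetRCertificateAssembly
end Summit.NavierStokesRegularity.OSWSelfSimilar

end
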